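import Literature.Computability.MetaComplexity.ResolutionWidth
import Mathlib.Logic.Relation
import Mathlib.Data.Nat.Log
import HarnessLib

/-!
# The Ben-Sasson–Wigderson size–width relation for TREE-LIKE resolution

**BSW Theorem 3.3 / Corollary 3.4** (Ben-Sasson–Wigderson 2001): a CNF `F` all of whose clauses
have width `≤ W` with a tree-like resolution refutation of size `S_T` has a refutation of width
`≤ W + log₂ S_T`; hence `S_T ≥ 2^{w(F ⊢ 0) - w(F)}`. Companion of `ResolutionSizeWidth.lean`
(the dag-like relation, Thm 3.5).

Refutations are the tree's list refutations (`Resolution.lean`: `IsResDerivation`,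
`IsResRefutation`, `IsTreeLike` — every line is used as a premise at most once); widths of the
produced refutations are measured by BSW's calculus `ResDerivable` (`ResolutionWidth.lean`), as in
the dag-like file. The printed proof decomposes a tree-like refutation at its last step into the
two sub-refutations of `F|_{x=0}` and `F|_{x=1}`, one of which has at most half the size, and
recombines by Lemma 3.2 (`ResDerivable.of_split`). On list refutations the decomposition is
phrased through ANCESTOR SETS: `ancestors π k`, the lines from which line `k` is reachable along
premise edges (`Consumes π a b`: line `b` uses line `a` as a premise). Tree-likeness makes
`Consumes π` right-unique (`consumes_rightUnique`, every line has at most one consumer), so the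
ancestor sets of the two premises of a resolution step are disjoint
(`disjoint_ancestors_of_consumes`) and their sizes add up below the size of the conclusion's
(`card_ancestors_add_lt`) — the list form of "`S = S₁ + S₂ + 1`". The node-by-node statement
`resDerivable_restrict_of_card_ancestors_le` (for every line `k` and every restriction `ρ`
falsifying its clause, `F|ρ ⊢_{W + log₂ |ancestors k|} 0`) is proved by strong induction on the
size bound; `resDerivable_of_isTreeLike` is Theorem 3.3 and `pow_le_length_of_isTreeLike`
Corollary 3.4.

## References

* E. Ben-Sasson, A. Wigderson, *Short proofs are narrow — resolution made simple*, J. ACM 48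
  (2001) 149–169, §2 (tree-like resolution), Theorem 3.3, Corollary 3.4, Lemmas 3.1–3.2.
  [BenSassonWigderson2001]
-/

namespace Literature.Computability.MetaComplexity

open Literature.Computability.Complexity

variable {ν : Type*}

/-! ### Premise edges and ancestor sets of a list derivation -/

section Ancestors

variable {π : List (ResLine ν)}

/-- `Consumes π a b`: line `b` of the derivation `π` uses line `a` as a premise (an edge of the
proof dag, from premise to conclusion). [Ben-Sasson–Wigderson 2001, §2 (the proof dag `G_π`)]
[folklore] -/
def Consumes (π : List (ResLine ν)) (a b : ℕ) : Prop :=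
  ∃ hb : b < π.length, a ∈ (π[b]'hb).premises

/-- In a derivation, premises come earlier. [Krajíček 2019, §5.1] [folklore] -/
theorem Consumes.lt [DecidableEq ν] {φ : CNF ν} (hπ : IsResDerivation φ π) {a b : ℕ}
    (h : Consumes π a b) : a < b := by
  obtain ⟨hb, ha⟩ := h
  have hv := hπ b hb
  have hlen : (π.take b).length = b := by simp [hb.le]
  unfold IsValidResLine at hv
  rcases hrule : (π[b]'hb).rule with _ | ⟨i, j, v⟩ | ⟨i⟩
  · simp [ResLine.premises, hrule, ResRule.premises] at ha
  · rw [hrule] at hv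
    obtain ⟨hi, hj, -⟩ := hv
    rw [hlen] at hi hj
    simp only [ResLine.premises, hrule, ResRule.premises, List.mem_cons, List.not_mem_nil,
      or_false] at ha
    rcases ha with rfl | rfl <;> assumption
  · rw [hrule] at hv
    obtain ⟨hi, -⟩ := hv
    rw [hlen] at hi
    simp only [ResLine.premises, hrule, ResRule.premises, List.mem_cons, List.not_mem_nil,
      or_false] at ha
    subst ha
    exact hi

/-- A line reachable from `a` along premise edges comes no earlier than `a`. [folklore] -/
theorem le_of_reflTransGen_consumes [DecidableEq ν] {φ : CNF ν} (hπ : IsResDerivation φ π)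
    {a b : ℕ} (h : Relation.ReflTransGen (Consumes π) a b) : a ≤ b := by
  induction h with
  | refl => exact le_rfl
  | tail _ hbc ih => exact ih.trans (hbc.lt hπ).le

/-- **Tree-likeness = every line has at most one consumer**: in a tree-like derivation the
premise relation is right-unique. [Ben-Sasson–Wigderson 2001, §2 (tree-like: `G_π` is a tree)]
[folklore] -/
theorem consumes_rightUnique (htree : IsTreeLike π) : Relator.RightUnique (Consumes π) := by
  intro c p p' hp hp'
  obtain ⟨hp, hc⟩ := hp
  obtain ⟨hp', hc'⟩ := hp'
  by_contra hne
  have key : ∀ {a b : ℕ} (ha : a < π.length) (hb : b < π.length), a < b →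
      c ∈ (π[a]'ha).premises → c ∈ (π[b]'hb).premises → False := by
    intro a b ha hb hab hca hcb
    have hsum := htree c
    have hsplit : (π.map fun l => l.premises.count c).sum =
        ((π.take b).map fun l => l.premises.count c).sum +
          ((π.drop b).map fun l => l.premises.count c).sum := by
      rw [← List.sum_append, ← List.map_append, List.take_append_drop]
    have h1 : 1 ≤ ((π.take b).map fun l => l.premises.count c).sum := by
      have hmem : (π[a]'ha).premises.count c ∈ (π.take b).map fun l => l.premises.count c :=
        List.mem_map.2 ⟨π[a]'ha, List.mem_take_iff_getElem.2 ⟨a, by simp [hab, ha], by simp⟩, rfl⟩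
      exact le_trans (List.count_pos_iff.2 hca) (List.le_sum_of_mem hmem)
    have h2 : 1 ≤ ((π.drop b).map fun l => l.premises.count c).sum := by
      have hmem : (π[b]'hb).premises.count c ∈ (π.drop b).map fun l => l.premises.count c := by
        refine List.mem_map.2 ⟨π[b]'hb, ?_, rfl⟩
        rw [List.mem_iff_getElem]
        exact ⟨0, by simp; omega, by simp⟩
      exact le_trans (List.count_pos_iff.2 hcb) (List.le_sum_of_mem hmem)
    omega
  rcases lt_or_gt_of_ne hne with h | h
  · exact key hp hp' h hc hc'
  · exact key hp' hp h hc' hc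

/-- In a tree-like derivation the two premises of a resolution step are different lines.
[folklore] -/
theorem ne_of_isTreeLike_resolve (htree : IsTreeLike π) {p i j : ℕ} {v : ν} (hp : p < π.length)
    (hrule : (π[p]'hp).rule = .resolve i j v) : i ≠ j := by
  intro hij
  subst hij
  have hsum := htree i
  have hmem : (π[p]'hp).premises.count i ∈ π.map fun l => l.premises.count i :=
    List.mem_map.2 ⟨π[p]'hp, List.getElem_mem hp, rfl⟩
  have h2 : (π[p]'hp).premises.count i = 2 := by
    simp [ResLine.premises, hrule, ResRule.premises]
  have := List.le_sum_of_mem hmem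
  omega

/-- The ANCESTOR SET of line `k`: the lines `a ≤ k` from which `k` is reachable along premise
edges (including `k` itself) — the sub-derivation ending in line `k`.
[Ben-Sasson–Wigderson 2001, §2] [folklore] -/
noncomputable def ancestors (π : List (ResLine ν)) (k : ℕ) : Finset ℕ := by
  classical exact (Finset.range (k + 1)).filter fun a => Relation.ReflTransGen (Consumes π) a k

/-- Membership in the ancestor set (for derivations, where premise edges increase the index).
[folklore] -/
theorem mem_ancestors_iff [DecidableEq ν] {φ : CNF ν} (hπ : IsResDerivation φ π) {a k : ℕ} :
    a ∈ ancestors π k ↔ Relation.ReflTransGen (Consumes π) a k := by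
  classical
  unfold ancestors
  rw [Finset.mem_filter, Finset.mem_range, and_iff_right_iff_imp]
  intro h
  exact Nat.lt_succ_of_le (le_of_reflTransGen_consumes hπ h)

/-- A line is its own ancestor. [folklore] -/
theorem self_mem_ancestors (k : ℕ) : k ∈ ancestors π k := by
  classical
  unfold ancestors
  rw [Finset.mem_filter, Finset.mem_range]
  exact ⟨Nat.lt_succ_self k, Relation.ReflTransGen.refl⟩

/-- The ancestor set of line `k` has at most `k + 1` elements. [folklore] -/
theorem card_ancestors_le (k : ℕ) : (ancestors π k).card ≤ k + 1 := by
  classical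
  unfold ancestors
  exact (Finset.card_filter_le _ _).trans (by simp)

/-- Ancestors of a premise are ancestors of the conclusion. [folklore] -/
theorem ancestors_subset_of_consumes [DecidableEq ν] {φ : CNF ν} (hπ : IsResDerivation φ π)
    {a k : ℕ} (h : Consumes π a k) : ancestors π a ⊆ ancestors π k := by
  intro x hx
  rw [mem_ancestors_iff hπ] at hx ⊢
  exact hx.tail h

/-- A line is not an ancestor of its premises. [folklore] -/
theorem notMem_ancestors_of_consumes [DecidableEq ν] {φ : CNF ν} (hπ : IsResDerivation φ π)
    {a k : ℕ} (h : Consumes π a k) : k ∉ ancestors π a := by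
  intro hk
  rw [mem_ancestors_iff hπ] at hk
  have h1 := le_of_reflTransGen_consumes hπ hk
  have h2 := h.lt hπ
  omega

/-- **In a tree-like derivation the sub-derivations of two premises of one line are disjoint.**
[Ben-Sasson–Wigderson 2001, §2 (tree-like refutations)] [folklore] -/
theorem disjoint_ancestors_of_consumes [DecidableEq ν] {φ : CNF ν} (hπ : IsResDerivation φ π)
    (htree : IsTreeLike π) {i j k : ℕ} (hi : Consumes π i k) (hj : Consumes π j k) (hij : i ≠ j) :
    Disjoint (ancestors π i) (ancestors π j) := by
  rw [Finset.disjoint_left]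
  intro x hxi hxj
  rw [mem_ancestors_iff hπ] at hxi hxj
  have hU := consumes_rightUnique htree
  -- the consumer chain from `x` is a path containing both `i` and `j`
  have key : ∀ {i j : ℕ}, Consumes π i k → Consumes π j k → i ≠ j →
      ¬ Relation.ReflTransGen (Consumes π) i j := by
    intro i j hi hj hij hij'
    rcases hij'.cases_head with h | ⟨c, hic, hcj⟩
    · exact hij h
    · have hck : c = k := hU hic hi
      subst hck
      have h1 := le_of_reflTransGen_consumes hπ hcj
      have h2 := hj.lt hπ
      omega
  rcases Relation.ReflTransGen.total_of_right_unique hU hxi hxj with h | h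
  · exact key hi hj hij h
  · exact key hj hi hij.symm h

/-- **Sizes of sub-derivations add up**: for a line `k` with two distinct premises `i, j` of a
tree-like derivation, `|ancestors i| + |ancestors j| < |ancestors k|`.
[Ben-Sasson–Wigderson 2001, proof of Thm 3.3 (`S = S₁ + S₂ + 1`)] [folklore] -/
theorem card_ancestors_add_lt [DecidableEq ν] {φ : CNF ν} (hπ : IsResDerivation φ π)
    (htree : IsTreeLike π) {i j k : ℕ} (hi : Consumes π i k) (hj : Consumes π j k) (hij : i ≠ j) :
    (ancestors π i).card + (ancestors π j).card < (ancestors π k).card := by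
  classical
  have hdisj := disjoint_ancestors_of_consumes hπ htree hi hj hij
  have hsub : ancestors π i ∪ ancestors π j ⊆ (ancestors π k).erase k := by
    intro x hx
    rw [Finset.mem_erase]
    rcases Finset.mem_union.1 hx with h | h
    · exact ⟨fun hxk => notMem_ancestors_of_consumes hπ hi (hxk ▸ h),
        ancestors_subset_of_consumes hπ hi h⟩
    · exact ⟨fun hxk => notMem_ancestors_of_consumes hπ hj (hxk ▸ h),
        ancestors_subset_of_consumes hπ hj h⟩
  have h1 := Finset.card_le_card hsub
  rw [Finset.card_union_of_disjoint hdisj,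
    Finset.card_erase_of_mem (self_mem_ancestors k)] at h1
  have h2 : 0 < (ancestors π k).card := Finset.card_pos.2 ⟨k, self_mem_ancestors k⟩
  omega

/-- The sub-derivation of a (single) premise is smaller. [folklore] -/
theorem card_ancestors_lt_of_consumes [DecidableEq ν] {φ : CNF ν} (hπ : IsResDerivation φ π)
    {a k : ℕ} (h : Consumes π a k) : (ancestors π a).card < (ancestors π k).card := by
  classical
  refine Finset.card_lt_card ⟨ancestors_subset_of_consumes hπ h, fun hsub => ?_⟩
  exact notMem_ancestors_of_consumes hπ h (hsub (self_mem_ancestors k))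

end Ancestors

/-! ### Theorem 3.3: tree-like size bounds width -/

section SizeWidth

variable [DecidableEq ν] {φ : CNF ν} {π : List (ResLine ν)}

omit [DecidableEq ν] in
/-- A clause all of whose literals are falsified by `ρ` restricts to the empty clause and is not
satisfied. [folklore] -/
theorem restrictClause_eq_empty_of_falsified {ρ : ν → Option Bool} {C : Finset (Literal ν)}
    (h : ∀ l ∈ C, ρ l.1 = some (!l.2)) : restrictClause ρ C = ∅ ∧ ¬ SatisfiedBy ρ C := by
  constructor
  · ext l
    simp only [mem_restrictClause, Finset.notMem_empty, iff_false, not_and]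
    intro hl hnone
    rw [h l hl] at hnone
    exact Option.some_ne_none _ hnone
  · rintro ⟨l, hl, hρ⟩
    rw [h l hl] at hρ
    cases hb : l.2 <;> simp [hb] at hρ

/-- **BSW Theorem 3.3, node by node.** Let `π` be a tree-like derivation from a CNF `φ` whose
clauses have width `≤ W`. For every line `k` whose sub-derivation has at most `N` lines and every
restriction `ρ` falsifying all literals of the clause of line `k`, the empty clause is derivable
from `φ|ρ` in width `≤ W + ⌊log₂ N⌋`. (Induction on `N`: at a resolution step on `v` with `v`
unassigned, the smaller premise sub-derivation has `≤ N/2` lines, giving `φ|ρ[v:=b] ⊢_{w-1} 0`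
and `φ|ρ[v:=1-b] ⊢_w 0`, recombined by Lemma 3.2.)
[cite: BenSassonWigderson2001, Theorem 3.3] -/
theorem resDerivable_restrict_of_card_ancestors_le (hπ : IsResDerivation φ π) (htree : IsTreeLike π)
    {W : ℕ} (hW : ∀ D ∈ clauseSet φ, D.card ≤ W) :
    ∀ (N k : ℕ) (hk : k < π.length), (ancestors π k).card ≤ N →
      ∀ ρ : ν → Option Bool, (∀ l ∈ (π[k]'hk).clause, ρ l.1 = some (!l.2)) →
        ResDerivable (restrictFormula ρ (clauseSet φ)) (W + Nat.log 2 N) ∅ := by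
  intro N
  induction N using Nat.strong_induction_on with
  | _ N IH =>
  intro k hk hN ρ hρ
  have hv := hπ k hk
  have hlen : (π.take k).length = k := by simp [hk.le]
  unfold IsValidResLine at hv
  rcases hrule : (π[k]'hk).rule with _ | ⟨i, j, v⟩ | ⟨i⟩
  · -- an initial clause, falsified by `ρ`: its restriction is the empty clause
    rw [hrule] at hv
    have hmem : (π[k]'hk).clause ∈ clauseSet φ := hv
    obtain ⟨hres, hns⟩ := restrictClause_eq_empty_of_falsified hρ
    have hax := restrictClause_mem_restrictFormula (F := clauseSet φ) hmem hns
    rw [hres] at hax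
    exact ResDerivable.ax hax (Finset.empty_subset _) (by simp)
  · -- a resolution step on `v` from lines `i` (containing `v`) and `j` (containing `¬v`)
    rw [hrule] at hv
    obtain ⟨hi, hj, hvi, hvj, hres⟩ := hv
    rw [hlen] at hi hj
    have hik : i < π.length := hi.trans hk
    have hjk : j < π.length := hj.trans hk
    have hgi : (π.take k)[i]'(by rw [hlen]; exact hi) = π[i]'hik := List.getElem_take
    have hgj : (π.take k)[j]'(by rw [hlen]; exact hj) = π[j]'hjk := List.getElem_take
    rw [hgi] at hvi hres
    rw [hgj] at hvj hres
    have hci : Consumes π i k := ⟨hk, by simp [ResLine.premises, hrule, ResRule.premises]⟩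
    have hcj : Consumes π j k := ⟨hk, by simp [ResLine.premises, hrule, ResRule.premises]⟩
    have hij : i ≠ j := ne_of_isTreeLike_resolve htree hk hrule
    have hadd := card_ancestors_add_lt hπ htree hci hcj hij
    have hNi : (ancestors π i).card < N := by omega
    have hNj : (ancestors π j).card < N := by omega
    -- literals of the premises other than the pivot literal are falsified by `ρ`
    have hρi : ∀ l ∈ (π[i]'hik).clause, l ≠ (v, true) → ρ l.1 = some (!l.2) := fun l hl hne =>
      hρ l (by rw [hres]; exact Finset.mem_union_left _ (Finset.mem_erase.2 ⟨hne, hl⟩))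
    have hρj : ∀ l ∈ (π[j]'hjk).clause, l ≠ (v, false) → ρ l.1 = some (!l.2) := fun l hl hne =>
      hρ l (by rw [hres]; exact Finset.mem_union_right _ (Finset.mem_erase.2 ⟨hne, hl⟩))
    rcases hρv : ρ v with _ | b
    · -- `v` unassigned: split on `v` (Lemma 3.2), the smaller side one level narrower
      have hN3 : 3 ≤ N := by
        have h1 : 0 < (ancestors π i).card := Finset.card_pos.2 ⟨i, self_mem_ancestors i⟩
        have h2 : 0 < (ancestors π j).card := Finset.card_pos.2 ⟨j, self_mem_ancestors j⟩
        omega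
      have hlogN : 1 ≤ Nat.log 2 N := by
        rw [Nat.succ_le_iff, Nat.log_pos_iff]
        omega
      -- the two restricted refutations
      have hfi : ∀ l ∈ (π[i]'hik).clause, Function.update ρ v (some false) l.1 = some (!l.2) := by
        intro l hl
        by_cases hl' : l = (v, true)
        · subst hl'; simp
        · have h1 := hρi l hl hl'
          have hne : l.1 ≠ v := fun h => by rw [h, hρv] at h1; simp at h1
          rw [Function.update_of_ne hne]; exact h1
      have hfj : ∀ l ∈ (π[j]'hjk).clause, Function.update ρ v (some true) l.1 = some (!l.2) := by
        intro l hl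
        by_cases hl' : l = (v, false)
        · subst hl'; simp
        · have h1 := hρj l hl hl'
          have hne : l.1 ≠ v := fun h => by rw [h, hρv] at h1; simp at h1
          rw [Function.update_of_ne hne]; exact h1
      have hDi := IH _ hNi i hik le_rfl _ hfi
      have hDj := IH _ hNj j hjk le_rfl _ hfj
      have hWF : ∀ D ∈ clauseSet φ, D.card ≤ W + Nat.log 2 N - 1 + 1 := fun D hD =>
        (hW D hD).trans (by omega)
      have hw : W + Nat.log 2 N - 1 + 1 = W + Nat.log 2 N := by omega
      rcases le_or_gt (ancestors π i).card (ancestors π j).card with hle | hlt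
      · -- the `i`-side is the smaller one
        have hhalf : (ancestors π i).card ≤ N / 2 := by omega
        have hlogi : Nat.log 2 (ancestors π i).card ≤ Nat.log 2 N - 1 := by
          have := Nat.log_mono_right (b := 2) hhalf
          rwa [Nat.log_div_base] at this
        have h1 : ResDerivable (restrictFormula (Function.update ρ v (some false)) (clauseSet φ))
            (W + Nat.log 2 N - 1) ∅ := hDi.mono (by omega)
        have h2 : ResDerivable (restrictFormula (Function.update ρ v (some !false)) (clauseSet φ))
            (W + Nat.log 2 N - 1 + 1) ∅ := by
          rw [hw]; exact hDj.mono (by have := Nat.log_mono_right (b := 2) hNj.le; omega)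
        have := ResDerivable.of_split hρv hWF h1 h2
        rwa [hw] at this
      · -- the `j`-side is the smaller one
        have hhalf : (ancestors π j).card ≤ N / 2 := by omega
        have hlogj : Nat.log 2 (ancestors π j).card ≤ Nat.log 2 N - 1 := by
          have := Nat.log_mono_right (b := 2) hhalf
          rwa [Nat.log_div_base] at this
        have h1 : ResDerivable (restrictFormula (Function.update ρ v (some true)) (clauseSet φ))
            (W + Nat.log 2 N - 1) ∅ := hDj.mono (by omega)
        have h2 : ResDerivable (restrictFormula (Function.update ρ v (some !true)) (clauseSet φ))
            (W + Nat.log 2 N - 1 + 1) ∅ := by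
          rw [hw]; exact hDi.mono (by have := Nat.log_mono_right (b := 2) hNi.le; omega)
        have := ResDerivable.of_split hρv hWF h1 h2
        rwa [hw] at this
    · -- `v` assigned: one premise is entirely falsified by `ρ`
      cases b
      · have hfi : ∀ l ∈ (π[i]'hik).clause, ρ l.1 = some (!l.2) := by
          intro l hl
          by_cases hl' : l = (v, true)
          · subst hl'; simpa using hρv
          · exact hρi l hl hl'
        exact (IH _ hNi i hik le_rfl ρ hfi).mono
          (by have := Nat.log_mono_right (b := 2) hNi.le; omega)
      · have hfj : ∀ l ∈ (π[j]'hjk).clause, ρ l.1 = some (!l.2) := by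
          intro l hl
          by_cases hl' : l = (v, false)
          · subst hl'; simpa using hρv
          · exact hρj l hl hl'
        exact (IH _ hNj j hjk le_rfl ρ hfj).mono
          (by have := Nat.log_mono_right (b := 2) hNj.le; omega)
  · -- a weakening of line `i`
    rw [hrule] at hv
    obtain ⟨hi, hsub⟩ := hv
    rw [hlen] at hi
    have hik : i < π.length := hi.trans hk
    have hgi : (π.take k)[i]'(by rw [hlen]; exact hi) = π[i]'hik := List.getElem_take
    rw [hgi] at hsub
    have hci : Consumes π i k := ⟨hk, by simp [ResLine.premises, hrule, ResRule.premises]⟩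
    have hNi : (ancestors π i).card < N := lt_of_lt_of_le (card_ancestors_lt_of_consumes hπ hci) hN
    exact (IH _ hNi i hik le_rfl ρ fun l hl => hρ l (hsub hl)).mono
      (by have := Nat.log_mono_right (b := 2) hNi.le; omega)

/-- **BSW Theorem 3.3** (tree-like size bounds width): if the clauses of `φ` have width `≤ W` and
`π` is a tree-like resolution refutation of `φ`, then the empty clause is derivable from `φ` in
width `≤ W + ⌊log₂ |π|⌋`. [cite: BenSassonWigderson2001, Theorem 3.3] -/
theorem resDerivable_of_isTreeLike (hπ : IsResRefutation φ π) (htree : IsTreeLike π) {W : ℕ}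
    (hW : ∀ D ∈ clauseSet φ, D.card ≤ W) :
    ResDerivable (clauseSet φ) (W + Nat.log 2 π.length) ∅ := by
  obtain ⟨hder, l, hl, hle⟩ := hπ
  obtain ⟨r, hr, rfl⟩ := List.getElem_of_mem hl
  have h := resDerivable_restrict_of_card_ancestors_le hder htree hW π.length r hr
    ((card_ancestors_le r).trans hr) (fun _ => none) (fun l hl => by rw [hle] at hl; simp at hl)
  simpa using h

/-- **BSW Corollary 3.4** (width lower bounds give tree-like size lower bounds): if the clauses
of `φ` have width `≤ W` and the empty clause is NOT derivable from `φ` in width `w`, then every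
tree-like resolution refutation of `φ` has more than `2^{w - W}` lines: `2^{w + 1 - W} ≤ |π|`.
[cite: BenSassonWigderson2001, Corollary 3.4] -/
theorem pow_le_length_of_isTreeLike (hπ : IsResRefutation φ π) (htree : IsTreeLike π) {W w : ℕ}
    (hW : ∀ D ∈ clauseSet φ, D.card ≤ W) (hw : ¬ ResDerivable (clauseSet φ) w ∅) :
    2 ^ (w + 1 - W) ≤ π.length := by
  have hD := resDerivable_of_isTreeLike hπ htree hW
  have hlt : w < W + Nat.log 2 π.length := by
    by_contra h
    exact hw (hD.mono (by omega))
  have hpos : π.length ≠ 0 := by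
    obtain ⟨-, l, hl, -⟩ := hπ
    exact List.ne_nil_iff_length_pos.1 (List.ne_nil_of_mem hl) |>.ne'
  calc 2 ^ (w + 1 - W) ≤ 2 ^ Nat.log 2 π.length := Nat.pow_le_pow_right (by norm_num) (by omega)
    _ ≤ π.length := Nat.pow_log_le_self 2 hpos

end SizeWidth

end Literature.Computability.MetaComplexity
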